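import Summits.Ventures.HodgeRepro2.T5CharacterTheory
import Summits.Ventures.HodgeRepro2.T5AbelianCharacterDetermines

/-!
# The character determines a representation — every compact group

For continuous finite-dimensional representations `π`, `π'` of a compact Hausdorff group `G`
(not necessarily commutative), equal characters give equivalent representations: an intertwining
linear equivalence `e : V ≃ₗ[ℂ] V'` exists.  This closes the last-column item of
`T5CharacterDetermines` / §S4.11 row 6 of `T5-SUPPORT-p1.md` («the converse — the construction of
the equivalence») for every compact group; `T5CircleCharacterDetermines` did `K = Circle` and
`T5AbelianCharacterDetermines` the compact abelian case.

The proof is by strong induction on `dim V`: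
* `dim V = 0`: both spaces are zero (`T5CharacterDetermines.finrank_eq_of_character_eq`).
* otherwise pick an irreducible stable `W ≤ V` (`T5CompleteReducibility.exists_irreducibleSubspace_le`)
  and let `σ = π|W`.  The multiplicity count
  `∫ χ_ρ · conj χ_σ = #{summands of an irreducible decomposition of ρ equivalent to σ}`
  (`integral_character_mul_conj_eq_sum`, from `T5CharacterTheory.integral_character_mul_conj_eq_ite`)
  shows that `π'` contains a copy `W'` of `σ` (`exists_copy_of_character_eq`): the count for `π` is
  `1 + (count for the stable complement of W) ≥ 1`, and it equals the count for `π'`.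
* stable complements `C`, `C'` of `W`, `W'` (`T5AveragedProjection.exists_isCompl_isStable_of_compact`)
  have equal characters (`character_eq_add_of_isCompl`), and `dim C < dim V`; the induction
  hypothesis gives `C ≃ C'`, and `exists_linearEquiv_of_isCompl` glues `W ≃ W'` and `C ≃ C'` along
  `V = W ⊕ C`, `V' = W' ⊕ C'` (`Submodule.prodEquivOfIsCompl`).

Blind lane: Mathlib + own prefix only; no sorry; axioms ⊆ {propext, Classical.choice, Quot.sound}.
-/

namespace Summit.Ventures.HodgeRepro2.T5CharacterDeterminesGeneral

open T5SchurOrthogonality T5CompleteReducibility T5RestrictionRep T5Multiplicity T5SchurMathlib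
  MeasureTheory

universe u u'

variable {G : Type*} [Group G]

section Algebraic

variable {V : Type u} [NormedAddCommGroup V] [InnerProductSpace ℂ V]
  {V' : Type u'} [NormedAddCommGroup V'] [InnerProductSpace ℂ V']

/-- The linear equivalence underlying a `Representation.Equiv` between `toRep σ` and `toRep τ`
intertwines `σ` and `τ`. -/
theorem toLinearEquiv_apply_apply (σ : G →* V →L[ℂ] V) (τ : G →* V' →L[ℂ] V')
    (e : (toRep σ).Equiv (toRep τ)) (g : G) (w : V) :
    e.toLinearEquiv (σ g w) = τ g (e.toLinearEquiv w) := by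
  have h := LinearMap.congr_fun (toLinearMap_eq_conj σ τ e g) (e.toLinearEquiv w)
  rw [LinearEquiv.conj_apply_apply, LinearEquiv.symm_apply_apply, ContinuousLinearMap.coe_coe,
    ContinuousLinearMap.coe_coe] at h
  exact h.symm

/-- An intertwining linear equivalence packaged as Mathlib's `Representation.Equiv`. -/
def repEquivOfLinearEquiv (π : G →* V →L[ℂ] V) (π' : G →* V' →L[ℂ] V') (e : V ≃ₗ[ℂ] V')
    (he : ∀ (g : G) (v : V), e (π g v) = π' g (e v)) : (toRep π).Equiv (toRep π') :=
  Representation.Equiv.mk e fun g => LinearMap.ext fun v => he g v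

/-- **Gluing along complements.** Intertwining equivalences `W ≃ W'` and `C ≃ C'` for stable
complements `V = W ⊕ C`, `V' = W' ⊕ C'` give an intertwining equivalence `V ≃ V'`. -/
theorem exists_linearEquiv_of_isCompl (π : G →* V →L[ℂ] V) (π' : G →* V' →L[ℂ] V')
    {W C : Submodule ℂ V} {W' C' : Submodule ℂ V'} (hW : IsStable π W) (hC : IsStable π C)
    (hW' : IsStable π' W') (hC' : IsStable π' C') (hWC : IsCompl W C) (hWC' : IsCompl W' C')
    (e₁ : W ≃ₗ[ℂ] W') (he₁ : ∀ (g : G) (x : W), e₁ (restrictRep π W hW g x) = restrictRep π' W' hW' g (e₁ x))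
    (e₂ : C ≃ₗ[ℂ] C') (he₂ : ∀ (g : G) (y : C), e₂ (restrictRep π C hC g y) = restrictRep π' C' hC' g (e₂ y)) :
    ∃ e : V ≃ₗ[ℂ] V', ∀ (g : G) (v : V), e (π g v) = π' g (e v) := by
  let e : V ≃ₗ[ℂ] V' :=
    (W.prodEquivOfIsCompl C hWC).symm.trans ((e₁.prodCongr e₂).trans (W'.prodEquivOfIsCompl C' hWC'))
  have hl : ∀ x : W, e x = e₁ x := by
    intro x
    simp only [e, LinearEquiv.trans_apply, Submodule.prodEquivOfIsCompl_symm_apply_left,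
      LinearEquiv.prodCongr_apply, map_zero, Submodule.coe_prodEquivOfIsCompl', Submodule.coe_zero,
      add_zero]
  have hr : ∀ y : C, e y = e₂ y := by
    intro y
    simp only [e, LinearEquiv.trans_apply, Submodule.prodEquivOfIsCompl_symm_apply_right,
      LinearEquiv.prodCongr_apply, map_zero, Submodule.coe_prodEquivOfIsCompl', Submodule.coe_zero,
      zero_add]
  refine ⟨e, fun g v => ?_⟩
  obtain ⟨x, y, rfl⟩ : ∃ x : W, ∃ y : C, v = x + y := by
    have hv : v ∈ W ⊔ C := by rw [hWC.sup_eq_top]; exact Submodule.mem_top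
    obtain ⟨x, hx, y, hy, hxy⟩ := Submodule.mem_sup.1 hv
    exact ⟨⟨x, hx⟩, ⟨y, hy⟩, hxy.symm⟩
  calc e (π g (↑x + ↑y)) = e (π g ↑x) + e (π g ↑y) := by rw [map_add, map_add]
    _ = ↑(e₁ (restrictRep π W hW g x)) + ↑(e₂ (restrictRep π C hC g y)) := by
        rw [← coe_restrictRep_apply π W hW g x, ← coe_restrictRep_apply π C hC g y, hl, hr]
    _ = ↑(restrictRep π' W' hW' g (e₁ x)) + ↑(restrictRep π' C' hC' g (e₂ y)) := by rw [he₁, he₂]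
    _ = π' g ↑(e₁ x) + π' g ↑(e₂ y) := by rw [coe_restrictRep_apply, coe_restrictRep_apply]
    _ = π' g (e ↑x + e ↑y) := by rw [hl, hr, map_add (π' g)]
    _ = π' g (e (↑x + ↑y)) := by rw [map_add e]

/-- The character of a representation is the sum of the characters of the restrictions to two
stable complementary subspaces. -/
theorem character_eq_add_of_isCompl [FiniteDimensional ℂ V] (π : G →* V →L[ℂ] V)
    {W C : Submodule ℂ V} (hW : IsStable π W) (hC : IsStable π C) (hWC : IsCompl W C) (g : G) :
    character π g = character (restrictRep π W hW) g + character (restrictRep π C hC) g := by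
  classical
  let N : Fin 2 → Submodule ℂ V := ![W, C]
  have hint : DirectSum.IsInternal N :=
    (DirectSum.isInternal_submodule_iff_isCompl N (i := 0) (j := 1) (by decide)
      (by ext x; fin_cases x <;> simp)).2 hWC
  have hst : ∀ i, IsStable π (N i) := fun i => by fin_cases i <;> assumption
  have h := character_eq_sum_restrict π N hint hst g
  rw [Fin.sum_univ_two] at h
  exact h

end Algebraic

section Compact

variable [TopologicalSpace G] [IsTopologicalGroup G] [MeasurableSpace G] [BorelSpace G]
  [CompactSpace G] [T2Space G]
variable {V : Type u} [NormedAddCommGroup V] [InnerProductSpace ℂ V] [FiniteDimensional ℂ V]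
  {V' : Type u'} [NormedAddCommGroup V'] [InnerProductSpace ℂ V'] [FiniteDimensional ℂ V']

open scoped Classical in
/-- **The multiplicity count**: for a continuous `π`, a continuous irreducible `σ` and an
irreducible internal decomposition `S` of `V`,
`∫ χ_π · conj χ_σ = Σ_{W ∈ S} [σ ≃ π|W]` (each summand contributes `1` or `0`,
`T5CharacterTheory.integral_character_mul_conj_eq_ite`). -/
theorem integral_character_mul_conj_eq_sum (π : G →* V →L[ℂ] V) (hπ : Continuous π)
    {W₀ : Type*} [NormedAddCommGroup W₀] [InnerProductSpace ℂ W₀] [FiniteDimensional ℂ W₀]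
    [Nontrivial W₀] (σ : G →* W₀ →L[ℂ] W₀) (hσ : Continuous σ) (hσi : IsIrreducible σ)
    (S : Finset (Submodule ℂ V)) (hS : ∀ W ∈ S, IsIrreducibleSubspace π W)
    (hint : DirectSum.IsInternal fun W : S => (W : Submodule ℂ V)) :
    ∫ g, character π g * (starRingEnd ℂ) (character σ g) ∂haarProb G =
      ∑ W : S, if Nonempty ((toRep σ).Equiv (toRep (restrictRep π W (hS W W.2).2.1))) then 1
        else 0 := by
  classical
  have hst : ∀ W ∈ S, IsStable π W := fun W hW => (hS W hW).2.1
  have hchar := character_eq_sum_restrict_finset π S hint hst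
  have hfun : (fun g => character π g * (starRingEnd ℂ) (character σ g)) =
      fun g => ∑ W : S, character (restrictRep π W (hst W W.2)) g *
        (starRingEnd ℂ) (character σ g) := by
    funext g
    rw [hchar g, Finset.sum_mul]
  rw [hfun, integral_finsetSum]
  · refine Finset.sum_congr rfl fun W _ => ?_
    haveI := nontrivial_of_isIrreducibleSubspace π W (hS W W.2)
    exact T5CharacterTheory.integral_character_mul_conj_eq_ite (haarProb G) _ σ
      (continuous_restrictRep π hπ W _) hσ (isIrreducible_restrictRep π W (hS W W.2) _) hσi
  · intro W _
    exact T5CharacterTheory.integrable_character_mul_conj (haarProb G) _ σ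
      (continuous_restrictRep π hπ W _) hσ

/-- The multiplicity count is a natural number. -/
theorem exists_nat_integral_character_mul_conj (π : G →* V →L[ℂ] V) (hπ : Continuous π)
    {W₀ : Type*} [NormedAddCommGroup W₀] [InnerProductSpace ℂ W₀] [FiniteDimensional ℂ W₀]
    [Nontrivial W₀] (σ : G →* W₀ →L[ℂ] W₀) (hσ : Continuous σ) (hσi : IsIrreducible σ) :
    ∃ n : ℕ, ∫ g, character π g * (starRingEnd ℂ) (character σ g) ∂haarProb G = n := by
  classical
  obtain ⟨S, hS, hint⟩ := T5AveragedProjection.exists_isInternal_irreducible_of_compact π hπ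
  rw [integral_character_mul_conj_eq_sum π hπ σ hσ hσi S hS hint, Finset.sum_boole]
  exact ⟨_, rfl⟩

/-- **A copy of every irreducible constituent of `π` occurs in `π'`** when the characters agree:
for an irreducible stable `W ≤ V` there is an irreducible stable `W' ≤ V'` with
`π|W ≃ π'|W'`. -/
theorem exists_copy_of_character_eq (π : G →* V →L[ℂ] V) (π' : G →* V' →L[ℂ] V')
    (hπ : Continuous π) (hπ' : Continuous π') (h : character π = character π')
    {W : Submodule ℂ V} (hW : IsIrreducibleSubspace π W) :
    ∃ W' : Submodule ℂ V', ∃ hW' : IsIrreducibleSubspace π' W',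
      Nonempty ((toRep (restrictRep π W hW.2.1)).Equiv (toRep (restrictRep π' W' hW'.2.1))) := by
  classical
  set σ := restrictRep π W hW.2.1 with hσdef
  haveI : Nontrivial W := nontrivial_of_isIrreducibleSubspace π W hW
  have hσc : Continuous σ := continuous_restrictRep π hπ W _
  have hσi : IsIrreducible σ := isIrreducible_restrictRep π W hW _
  -- the count for `π` is `1 + (count for the complement)`
  obtain ⟨C, hC, hWC⟩ := T5AveragedProjection.exists_isCompl_isStable_of_compact π hπ hW.2.1
  have hsplit : (fun g => character π g * (starRingEnd ℂ) (character σ g)) =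
      fun g => character σ g * (starRingEnd ℂ) (character σ g) +
        character (restrictRep π C hC) g * (starRingEnd ℂ) (character σ g) := by
    funext g
    rw [character_eq_add_of_isCompl π hW.2.1 hC hWC g, add_mul]
  have hself : ∫ g, character σ g * (starRingEnd ℂ) (character σ g) ∂haarProb G = 1 := by
    rw [T5CharacterTheory.integral_character_mul_conj_eq_ite (haarProb G) σ σ hσc hσc hσi hσi,
      if_pos ⟨Representation.Equiv.refl _⟩]
  obtain ⟨n, hn⟩ := exists_nat_integral_character_mul_conj (restrictRep π C hC)
    (continuous_restrictRep π hπ C hC) σ hσc hσi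
  have hcount : ∫ g, character π g * (starRingEnd ℂ) (character σ g) ∂haarProb G = 1 + n := by
    rw [hsplit, integral_add, hself, hn]
    · exact T5CharacterTheory.integrable_character_mul_conj (haarProb G) σ σ hσc hσc
    · exact T5CharacterTheory.integrable_character_mul_conj (haarProb G) _ σ
        (continuous_restrictRep π hπ C hC) hσc
  -- the count for `π'` is a sum of `0`s and `1`s over an irreducible decomposition of `V'`
  obtain ⟨S', hS', hint'⟩ := T5AveragedProjection.exists_isInternal_irreducible_of_compact π' hπ'
  have hcount' := integral_character_mul_conj_eq_sum π' hπ' σ hσc hσi S' hS' hint'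
  by_contra hno
  have hno' : ∀ (W' : Submodule ℂ V') (hW' : IsIrreducibleSubspace π' W'),
      ¬ Nonempty ((toRep σ).Equiv (toRep (restrictRep π' W' hW'.2.1))) :=
    fun W' hW' hne => hno ⟨W', hW', hne⟩
  have hzero : (∑ W' : S', if Nonempty ((toRep σ).Equiv
      (toRep (restrictRep π' W' (hS' W' W'.2).2.1))) then (1 : ℂ) else 0) = 0 :=
    Finset.sum_eq_zero fun W' _ => if_neg (hno' W' (hS' W' W'.2))
  rw [hzero, ← h, hcount] at hcount'
  have : ((1 + n : ℕ) : ℂ) = 0 := by push_cast; exact hcount'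
  have h1n : 1 + n = 0 := by exact_mod_cast this
  omega

end Compact

section Main

variable [TopologicalSpace G] [IsTopologicalGroup G] [MeasurableSpace G] [BorelSpace G]
  [CompactSpace G] [T2Space G]

/-- The induction: for every `n`, continuous finite-dimensional representations of dimension `n`
with equal characters are equivalent. -/
theorem exists_linearEquiv_of_character_eq_aux (n : ℕ) :
    ∀ {V : Type u} [NormedAddCommGroup V] [InnerProductSpace ℂ V] [FiniteDimensional ℂ V]
      {V' : Type u'} [NormedAddCommGroup V'] [InnerProductSpace ℂ V'] [FiniteDimensional ℂ V']
      (π : G →* V →L[ℂ] V) (π' : G →* V' →L[ℂ] V'), Continuous π → Continuous π' →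
      Module.finrank ℂ V = n → character π = character π' →
      ∃ e : V ≃ₗ[ℂ] V', ∀ (g : G) (v : V), e (π g v) = π' g (e v) := by
  induction n using Nat.strong_induction_on with
  | _ n ih =>
  intro V _ _ _ V' _ _ _ π π' hπ hπ' hn h
  have hdim : Module.finrank ℂ V = Module.finrank ℂ V' := by
    have h1 := congrFun h 1
    rw [T5AbelianWeightIndependence.character_one, T5AbelianWeightIndependence.character_one] at h1
    exact_mod_cast h1
  by_cases hn0 : n = 0
  · subst hn0
    haveI : Subsingleton V := Module.finrank_zero_iff.1 hn
    haveI : Subsingleton V' := Module.finrank_zero_iff.1 (hdim ▸ hn)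
    exact ⟨LinearEquiv.ofFinrankEq V V' hdim, fun g v => Subsingleton.elim _ _⟩
  · have htop : (⊤ : Submodule ℂ V) ≠ ⊥ := by
      intro hbot
      apply hn0
      rw [← hn, ← finrank_top ℂ V, Submodule.finrank_eq_zero]
      exact hbot
    obtain ⟨W, -, hW⟩ := exists_irreducibleSubspace_le π (isStable_top π) htop
    obtain ⟨W', hW', ⟨eqv⟩⟩ := exists_copy_of_character_eq π π' hπ hπ' h hW
    obtain ⟨C, hC, hWC⟩ := T5AveragedProjection.exists_isCompl_isStable_of_compact π hπ hW.2.1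
    obtain ⟨C', hC', hWC'⟩ :=
      T5AveragedProjection.exists_isCompl_isStable_of_compact π' hπ' hW'.2.1
    have hchar : character (restrictRep π C hC) = character (restrictRep π' C' hC') := by
      funext g
      have h1 := character_eq_add_of_isCompl π hW.2.1 hC hWC g
      have h2 := character_eq_add_of_isCompl π' hW'.2.1 hC' hWC' g
      have h3 := character_eq_of_equiv _ _ eqv g
      have h4 := congrFun h g
      linear_combination -h1 + h2 + h4 + h3
    have hlt : Module.finrank ℂ C < n := by
      have hWpos : 0 < Module.finrank ℂ W :=
        Nat.pos_of_ne_zero fun h0 => hW.1 (Submodule.finrank_eq_zero.1 h0)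
      have := Submodule.finrank_add_eq_of_isCompl hWC
      omega
    obtain ⟨e₂, he₂⟩ := ih _ hlt (restrictRep π C hC) (restrictRep π' C' hC')
      (continuous_restrictRep π hπ C hC) (continuous_restrictRep π' hπ' C' hC') rfl hchar
    exact exists_linearEquiv_of_isCompl π π' hW.2.1 hC hW'.2.1 hC' hWC hWC' eqv.toLinearEquiv
      (toLinearEquiv_apply_apply _ _ eqv) e₂ he₂

variable {V : Type u} [NormedAddCommGroup V] [InnerProductSpace ℂ V] [FiniteDimensional ℂ V]
  {V' : Type u'} [NormedAddCommGroup V'] [InnerProductSpace ℂ V'] [FiniteDimensional ℂ V']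

/-- **The character determines the representation** (every compact Hausdorff group): two continuous
finite-dimensional representations with the same character are equivalent. -/
theorem exists_linearEquiv_of_character_eq (π : G →* V →L[ℂ] V) (π' : G →* V' →L[ℂ] V')
    (hπ : Continuous π) (hπ' : Continuous π') (h : character π = character π') :
    ∃ e : V ≃ₗ[ℂ] V', ∀ (g : G) (v : V), e (π g v) = π' g (e v) :=
  exists_linearEquiv_of_character_eq_aux _ π π' hπ hπ' rfl h

/-- **Equivalent ⟺ same character**, for continuous finite-dimensional representations of a compact
Hausdorff group. -/
theorem exists_linearEquiv_iff_character_eq (π : G →* V →L[ℂ] V) (π' : G →* V' →L[ℂ] V')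
    (hπ : Continuous π) (hπ' : Continuous π') :
    (∃ e : V ≃ₗ[ℂ] V', ∀ (g : G) (v : V), e (π g v) = π' g (e v)) ↔
      character π = character π' :=
  ⟨fun ⟨e, he⟩ => T5AbelianCharacterDetermines.character_eq_of_linearEquiv π π' e he,
    fun h => exists_linearEquiv_of_character_eq π π' hπ hπ' h⟩

/-- The same statement with Mathlib's `Representation.Equiv`:
`toRep π ≃ toRep π'` is inhabited iff the characters agree. -/
theorem nonempty_equiv_iff_character_eq (π : G →* V →L[ℂ] V) (π' : G →* V' →L[ℂ] V')
    (hπ : Continuous π) (hπ' : Continuous π') :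
    Nonempty ((toRep π).Equiv (toRep π')) ↔ character π = character π' := by
  constructor
  · rintro ⟨e⟩
    funext g
    exact (character_eq_of_equiv π π' e g).symm
  · intro h
    obtain ⟨e, he⟩ := exists_linearEquiv_of_character_eq π π' hπ hπ' h
    exact ⟨repEquivOfLinearEquiv π π' e he⟩

end Main

end Summit.Ventures.HodgeRepro2.T5CharacterDeterminesGeneral
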